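import Summits.HubbardSuperconductivity.HubbardSuperconductivity.Theorems.CooperPairDMottWalkDiluteBECBridgeNormalForm
import Summits.HubbardSuperconductivity.HubbardSuperconductivity.Theorems.CooperPairDMottWalkDiluteBECBridgeDichotomy
import Summits.HubbardSuperconductivity.HubbardSuperconductivity.Theorems.CooperPairDMottWalkGlue
import HarnessLib

/-!
# STRATEGY CENSUS r1 — typed companion, crux `DiluteBECBridge` (stmt-HubbardSuperconductivity-10314)

Crux-strategist REDIRECT `cstrat-stmt-HubbardSuperconductivity-10314-r1` (second opinion), 2026-08-17.
Companion of `Cruxes/DiluteBECBridge/STRATEGY-CENSUS-r1.md`. Nothing here is an item, a stub or a line: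
every theorem is bookkeeping over the route file and LANDED certificates
(`diluteBECBridge_iff_everyGSOrder` p150166, `diluteBECBridge_of_not_pureCooperPair` p152316,
`targetSuffices_proof`). Independent of the s1 companion `STRATEGY_CENSUS.lean` (no import; `CPkg`,
`CPinf` are re-declared verbatim so that the `let`-form of the crux is definitionally these names).

* §0  PLACEMENT — `SummitSection`, `crux_iff_forall_lit_section` (the crux is LITERALLY "the summit's
      `U`-section at every lit `U ∈ [2,8]`", `Iff.rfl`), `summit_iff_exists_section`, `target_iff_exists_lit`,
      `summit_of_crux_of_lit`, `crux_of_windowSummitAll`, `crux_decided_by_target`, `not_crux_iff_lit_dark`.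
* §M  MUTE SIDES — `VO42`, `muteSides_of_crux`: the hypothesis speaks only of sides `4k+4`, yet the crux
      already delivers the every-ground-state order floor on the sides `4k+2` it never mentions.
* §S  STRENGTHEN (typed only) — `Floor`, `SeedOctave`, `DoublingStep`, `UnitStepMonotone`: the scale-recursion
      strengthening S-R1 / split D-R2 of the census, with the covering defect recorded in the docstrings.
-/

set_option linter.dupNamespace false

noncomputable section

namespace Summit.HubbardSuperconductivity.HubbardSuperconductivity.Cruxes.DiluteBECBridge.CensusR1

open Matrix Filter
open Literature.Probability.LatticeModels Literature.MathematicalPhysics.QuantumLattice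
open Summit.HubbardSuperconductivity.HubbardSuperconductivity.Theses.CooperPairDMottWalk
open Summit.HubbardSuperconductivity.HubbardSuperconductivity.Theorems.CooperPairDMottWalk
open scoped ComplexOrder

/-! ## §0 Placement: the crux is the summit's `U`-section over the lit window -/

/-- The route's Cooper-pair package `CP L H ε z` ((a) binding, (b) unique two-hole floor,
(c) macroscopic `d`-wave amplitude), verbatim from the route file. -/
def CPkg (L : ℕ) [NeZero L]
    (H : Matrix (Finset (Orb (FermionTorus 2 L))) (Finset (Orb (FermionTorus 2 L))) ℂ) (ε z : ℝ) :
    Prop :=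
  H.minEnergyOn (szSector (L ^ 2 - 2) 0) + H.minEnergyOn (szSector (L ^ 2) 0) + ε ≤
      2 * H.minEnergyOn (szSector (L ^ 2 - 1) (1 / 2)) ∧
    (∀ φ₁ φ₂, IsGroundStateInSector H (L ^ 2 - 2) 0 φ₁ →
      IsGroundStateInSector H (L ^ 2 - 2) 0 φ₂ → ∃ c : ℂ, φ₂ = c • φ₁) ∧
    (∀ φ₀ φ₂, IsGroundStateInSector H (L ^ 2) 0 φ₀ →
      IsGroundStateInSector H (L ^ 2 - 2) 0 φ₂ →
        z * (L : ℝ) ^ 2 * (star φ₀ ⬝ᵥ φ₀).re * (star φ₂ ⬝ᵥ φ₂).re ≤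
          ‖star φ₂ ⬝ᵥ (pairField dWaveFormFactor L *ᵥ φ₀)‖ ^ 2)

/-- `CP∞(U)`: the crux's hypothesis at `U` — the pure-model Cooper-pair package on the sides `4k+4`,
`k ≥ k₀` (= the body of the route target `PureCooperPair` at `U`). -/
def CPinf (U : ℝ) : Prop :=
  ∃ ε > (0 : ℝ), ∃ z > (0 : ℝ), ∃ k₀ : ℕ, ∀ k ≥ k₀, CPkg (4 * k + 4) (hubbardTorus 2 (4 * k + 4) 1 U) ε z

/-- The SUMMIT'S `U`-SECTION: the body of `Literature.Hubbard.DWaveSuperconductivityHubbard` with its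
leading `∃ U, 0 < U ∧` removed — `d_{x²-y²}` pair-field LRO of EVERY normalised sector ground-state
sequence at filling `2⌊(1-δ)L²/2⌋` along the even sides, for some `δ ∈ (0, 1/2)`. -/
def SummitSection (U : ℝ) : Prop :=
  ∃ δ ∈ Set.Ioo (0 : ℝ) (1 / 2),
    ∀ (N : ℕ → ℕ) (ψ : ∀ L, Fock (Orb (FermionTorus 2 L))),
      (∀ L, Even L → N L = 2 * ⌊(1 - δ) * (L : ℝ) ^ 2 / 2⌋₊ ∧ star (ψ L) ⬝ᵥ ψ L = 1 ∧
          IsGroundStateInSector (hubbardTorus 2 L 1 U) (N L) 0 (ψ L)) →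
        HasLongRangeOrder (fun k => halfOpenBox 2 (2 * k))
          (fun k => torusPullback (pairFieldCorr dWaveFormFactor ψ) (2 * k))

/-- The summit is `∃ U > 0` of its section (definitional). -/
theorem summit_iff_exists_section :
    HubbardSuperconductivity ↔ ∃ U : ℝ, 0 < U ∧ SummitSection U :=
  Iff.rfl

/-- The route target is `∃ U ∈ [2,8]` of the crux's hypothesis (definitional). -/
theorem target_iff_exists_lit : PureCooperPair ↔ ∃ U ∈ Set.Icc (2 : ℝ) 8, CPinf U :=
  Iff.rfl

/-- **PLACEMENT.** The crux is, LITERALLY (`Iff.rfl`), the summit's `U`-section asserted at every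
`U ∈ [2,8]` at which the route target's package is lit. No normal form, no landed theorem is needed
for this reading: the conclusion of the crux at `U` and the summit's body at `U` are the same term. -/
theorem crux_iff_forall_lit_section :
    DiluteBECBridge ↔ ∀ U ∈ Set.Icc (2 : ℝ) 8, CPinf U → SummitSection U :=
  Iff.rfl

/-- A section at some `U > 0` is the summit. -/
theorem summit_of_section {U : ℝ} (hU : 0 < U) (h : SummitSection U) : HubbardSuperconductivity :=
  ⟨U, hU, h⟩

/-- At a lit `U` of the window the crux IS the summit (two lines). -/
theorem summit_of_crux_of_lit (h : DiluteBECBridge) {U : ℝ} (hU : U ∈ Set.Icc (2 : ℝ) 8)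
    (hlit : CPinf U) : HubbardSuperconductivity :=
  summit_of_section (by linarith [hU.1]) (crux_iff_forall_lit_section.1 h U hU hlit)

/-- Upper sandwich: the summit asserted at EVERY `U` of the window gives the crux (hypothesis unused). -/
theorem crux_of_windowSummitAll (h : ∀ U ∈ Set.Icc (2 : ℝ) 8, SummitSection U) : DiluteBECBridge :=
  crux_iff_forall_lit_section.2 fun U hU _ => h U hU

/-- **The crux is decided by the route's own target** (landed p152316 + `targetSuffices_proof`):
off the target it is vacuously true; on the target it is at least the summit. -/
theorem crux_decided_by_target :
    (¬ PureCooperPair → DiluteBECBridge) ∧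
      (PureCooperPair → DiluteBECBridge → HubbardSuperconductivity) :=
  ⟨diluteBECBridge_of_not_pureCooperPair, fun hT hB => targetSuffices_proof hT hB⟩

/-- NEGATION normal form in the literal reading: the crux fails iff some lit `U` of the window is DARK
(its summit section fails) — a negative summit on the ray `{U} × (0,1/2)` conjoined with the route
target at `U`. -/
theorem not_crux_iff_lit_dark :
    ¬ DiluteBECBridge ↔ ∃ U ∈ Set.Icc (2 : ℝ) 8, CPinf U ∧ ¬ SummitSection U := by
  rw [crux_iff_forall_lit_section]
  push Not
  rfl

/-! ## §M Mute sides: the hypothesis lives on `L ≡ 0 (mod 4)`, the conclusion does not -/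

/-- `VO₄₂(U, δ)`: the every-ground-state volume-order floor restricted to the sides `4k+2` — sides on
which the crux's hypothesis `CP∞` says NOTHING (it only constrains `hubbardTorus 2 (4k+4) 1 U`). -/
def VO42 (U δ : ℝ) : Prop :=
  ∃ c > (0 : ℝ), ∃ k₁ : ℕ, ∀ k ≥ k₁, ∀ ψ : Fock (Orb (FermionTorus 2 (4 * k + 2))),
    star ψ ⬝ᵥ ψ = 1 →
      IsGroundStateInSector (hubbardTorus 2 (4 * k + 2) 1 U)
          (2 * ⌊(1 - δ) * ((4 * k + 2 : ℕ) : ℝ) ^ 2 / 2⌋₊) 0 ψ →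
        c * ((4 * k + 2 : ℕ) : ℝ) ^ 4 ≤
          (expect ((pairField dWaveFormFactor (4 * k + 2))ᴴ * pairField dWaveFormFactor (4 * k + 2)) ψ).re

/-- **MUTE SIDES.** From the crux and a lit `U`, the every-ground-state `d`-wave order floor on the
sides `4k+2` follows (landed normal form p150166, instantiated at `L = 4k+2`): the crux obliges a
prover to establish macroscopic pair order of EVERY sector ground state on an infinite family of tori
about which its hypothesis is silent — on those sides the crux is the bare summit section, with no
input at all. Any proof must therefore contain an input-free order mechanism at `(U, δ)`. -/
theorem muteSides_of_crux (h : DiluteBECBridge) {U : ℝ} (hU : U ∈ Set.Icc (2 : ℝ) 8)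
    (hlit : CPinf U) : ∃ δ ∈ Set.Ioo (0 : ℝ) (1 / 2), VO42 U δ := by
  obtain ⟨δ, hδ, c, hc, L₁, hL⟩ := diluteBECBridge_iff_everyGSOrder.1 h U hU hlit
  refine ⟨δ, hδ, c, hc, L₁, fun k hk ψ hψ hGS => ?_⟩
  haveI : NeZero (4 * k + 2) := ⟨by omega⟩
  have hle : L₁ ≤ 4 * k + 2 := by omega
  have hev : Even (4 * k + 2) := ⟨2 * k + 1, by ring⟩
  exact hL (4 * k + 2) hle hev ψ hψ hGS

/-! ## §S Strengthen / Decomposition D-R2 (typed only): scale recursion for the order floor -/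

/-- `Floor U δ L a`: every normalised `(N_L, 0)`-sector ground state of side `L` has
`⟨Δ_d† Δ_d⟩ ≥ a L⁴` (`N_L = 2⌊(1-δ)L²/2⌋`). `VO U δ` of the normal form is `∃ a > 0, ∃ L₁, ∀ L ≥ L₁ even,
Floor U δ L a`. -/
def Floor (U δ : ℝ) (L : ℕ) [NeZero L] (a : ℝ) : Prop :=
  ∀ ψ : Fock (Orb (FermionTorus 2 L)), star ψ ⬝ᵥ ψ = 1 →
    IsGroundStateInSector (hubbardTorus 2 L 1 U) (2 * ⌊(1 - δ) * (L : ℝ) ^ 2 / 2⌋₊) 0 ψ →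
      a * (L : ℝ) ^ 4 ≤ (expect ((pairField dWaveFormFactor L)ᴴ * pairField dWaveFormFactor L) ψ).re

/-- S-R1 seed: the floor on one octave of sides `[L₀, 2L₀)` (a FINITE computation in principle;
infeasible beyond `L₀ = 4`: the `(N_L,0)` sector of the `6 × 6` torus has dimension `≈ 10¹⁹`). -/
def SeedOctave (U δ c : ℝ) (L₀ : ℕ) : Prop :=
  ∀ (L : ℕ) [NeZero L], L₀ ≤ L → L < 2 * L₀ → Floor U δ L c

/-- S-R1 doubling step: the floor passes from side `L` to side `2L` with a summable loss. COVERING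
DEFECT (census §Strengthen): doubling from an octave of seeds reaches only the sides `2ʲ·m`,
`m ∈ [L₀, 2L₀)` — e.g. with `L₀ = 4` the even side `18 = 2·9` is never reached — so this step alone
cannot discharge to `VO` (all even sides); a unit-step monotonicity (`UnitStepMonotone`) is needed too. -/
def DoublingStep (U δ C θ : ℝ) (L₀ : ℕ) : Prop :=
  ∀ (L : ℕ) [NeZero L], L₀ ≤ L → ∀ a : ℝ, Floor U δ L a → Floor U δ (2 * L) (a - C * (L : ℝ) ^ (-θ))

/-- S-R1 unit step: volume quasi-monotonicity of the order floor, `m(L+2) ≥ m(L) − C L^{-θ}` with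
`θ > 1` (summable along `L₀, L₀+2, …`). ENGINE-LESS (census §Strengthen): the only volume-monotonicity
mechanism for order parameters in print is Griffiths' second inequality (ferromagnetic / free boundary
conditions; tree `griffiths_second` for even lattice scalar fields), which has no fermionic or
quantum-`U(1)` ground-state analogue; and LRO forces gapless towers
(`Literature.Barriers.HubbardSuperconductivity.LROForcesLowLyingStates`), so no Knabe-type finite-size
criterion transfers either. -/
def UnitStepMonotone (U δ C θ : ℝ) (L₀ : ℕ) : Prop :=
  ∀ (L : ℕ) [NeZero L], L₀ ≤ L → Even L → ∀ a : ℝ,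
    Floor U δ L a → Floor U δ (L + 2) (a - C * (L : ℝ) ^ (-θ))

/-- The floor is monotone in its constant (bookkeeping used by any telescoping discharge). -/
theorem Floor.mono {U δ : ℝ} {L : ℕ} [NeZero L] {a b : ℝ} (hab : b ≤ a) (h : Floor U δ L a) :
    Floor U δ L b := fun ψ hψ hGS =>
  (mul_le_mul_of_nonneg_right hab (by positivity)).trans (h ψ hψ hGS)

/-- One telescoping step of the (engine-less) discharge: a seed at `L` and the unit step give the
floor at `L + 2` with the budgeted constant. The full discharge to `VO U δ` is the `ℕ`-induction of
this step with `Σ_L C L^{-θ} ≤ c/2`; it is not carried out here because the step itself has no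
supplier (census §Strengthen / §Decomposition D-R2). -/
theorem floor_succ_of_unitStep {U δ C θ c : ℝ} {L₀ L : ℕ} [NeZero L]
    (hstep : UnitStepMonotone U δ C θ L₀) (hL : L₀ ≤ L) (hev : Even L) (h : Floor U δ L c) :
    Floor U δ (L + 2) (c - C * (L : ℝ) ^ (-θ)) :=
  hstep L hL hev c h

end Summit.HubbardSuperconductivity.HubbardSuperconductivity.Cruxes.DiluteBECBridge.CensusR1
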